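import Literature.MathematicalPhysics.QuantumFieldTheory.Balaban1983to89.B9Eq3132NuReading
import Literature.MathematicalPhysics.QuantumFieldTheory.Balaban1983to89.B9BackgroundsKLevelV1R

/-!
# `Balaban1983to89.B9Eq3132NuReadingR` — T. Bałaban, *Propagators for lattice gauge theories in a background field*, Commun. Math. Phys. **99** (1985) 389–434
# [Balaban1985BackgroundPropagators], (3.132) p. 422 under Theorem 3.12's prefix p. 423: ROW 26's `ν`-READ FACE `s3132Nu_opsYNuOfRecordV4E` RE-PRESSED ONCE AT
# def-Y's CLASS-PARAMETRIC CARRIER `bg9YR 𝔸 G R₁ R₂` (CASCADE-R: the two (3.35)∕(3.36) predicate families as PARAMETERS) — the same proof text, `bg9Y ↦ bg9YR … R₁ R₂`,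
# the kernels read through `siteKernelR R₁ R₂`; specialises to the landed face at `(regY335, regY336)` by `rfl`

[4] = T. Bałaban, *Propagators and renormalization transformations for lattice gauge theories. II*, Commun. Math. Phys. **96** (1984) 223–250 [`Balaban1984PropagatorsII`].

statement-level skeleton of published theorems with citation tags; proofs where landed; nothing here is a claim about the Yang–Mills mass gap

THE PRINT.  [B9] p. 422 (3.132) *«|(QG̃Q*)⁻¹(y, y′)| ≤ O(1)(Lʲη)⁻²(L^{j′}η)^{−d}e^{−δ₁d(y,y′)} … and the same for the operator with G₁»*, under the prefix of Theorem 3.12 p. 423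
*«If an external gauge field configuration U satisfies both regularity conditions (3.35), (3.36) for α₀ sufficiently small»*; p. 396 (3.35)–(3.36) (the regularity classes).

WHY THIS FILE (dag-n06-i gen 13; dag-lead GO-CASCADE-R l.20040, node00-def-Y FILE 18a∕18b = `B9BackgroundsKLevelV1R` ∕ `B9PinCarriersKLevelV1R`, p535128 ∕ p535412).
def-Y re-issued NODE 00's background carrier class-parametrically: `bg9YR 𝔸 G R₁ R₂ x := { bg9K 𝔸 G x.toKIdx with Reg335 := R₁ x, Reg336 := R₂ x }`, with
`bg9Y 𝔸 G x = bg9YR 𝔸 G (regY335 𝔸 G) (regY336 𝔸 G) x` by `rfl`, and asked each owner of a theorem the N06 certificate pins to re-press it ONCE at generic `(R₁, R₂)` so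
that the n06-d successor can press certificate EDITION 8 at `carriersYR … R₁ R₂ ops` and specialise it by `rfl` to print's class (and to any later class amendment).  Of
n06-i's two pinned row-26 faces, `s3132Nu_opsYNuOfRecordV4E` (`B9Eq3132NuReading`, the face of record since edition 5) is re-pressed here; the flat-reading face
`s3132_opsYOfRecordDE` (`B9Eq3132AtRecordDE`) is LOCATED-FALSE (`B9Eq3132FlatReadingAtRecord.not_s3132_opsYOfRecordDE`) and no edition since 5 consumes it — no twin
is owed for it.  The `ν`-pipeline (`stmt3132Printed_geo9Y_of_coercive_decay_idx` → `QGQInverse.inverse_decay`) is ALREADY generic in the background family `bg` and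
consumes NO class axiom (neither `MemOfFam` nor `Imp336335`): the twin is the landed proof text with `bg9Y ↦ bg9YR 𝔸 G R₁ R₂` and nothing displayed.

WHAT IS PROVED (sorry-free).
* §1 ★ `stmt3132Printed_nu_of_coercive_decay_R` — `B9.Stmt3132Printed dd c35 geo9Y (bg9YR 𝔸 G R₁ R₂) (ν-reading of Ring.inverse∘T) (ν-reading of Ring.inverse∘T₁)`
  from the four Λ-normalised binders stated over `bg9YR 𝔸 G R₁ R₂` (g7's `stmt3132Printed_nu_of_coercive_decay` verbatim at the parametric carrier).
* §2 `siteKernelR_opsYNuOfRecordV4E_QGQinv ∕ _QG1Qinv` (`rfl`: the re-typed kernels ARE the `ν`-readings at `bg9YR`), ★★★ `s3132Nu_opsYNuOfRecordV4E_R (R₁ R₂) … b hco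
  hdec hco₁ hdec₁ : B9.Stmt3132Printed (θ.d₆+1) c35 geo9Y (bg9YR M_N(ℂ) SU(N) R₁ R₂) (fun x => siteKernelR R₁ R₂ (opsYNuOfRecordV4E … x).QGQinv)
  (fun x => siteKernelR R₁ R₂ (opsYNuOfRecordV4E … x).QG1Qinv)` — THE EDITION-8 ROW-26 FACE; `s3132Nu_opsYNuOfRecordV4E_R_regY` (at `(regY335, regY336)` it IS the landed face,
  `rfl` on both sides).

HONEST SCOPE.  Re-typing bookkeeping (CASCADE-R step 2 for n06-i); the four binders are the same displayed (3.132)-strength hypotheses as before (after `B9Eq3132CoerciveFromGA`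
∕ `…CoerciveVariational` the knit may display `hcoA` ∕ `hΔA` + a test family instead — those faces are generic in `bg` as well); nothing of [B9] is asserted;
count-neutral; N06 NOT discharged; nothing continuum, nothing OS, nothing about the mass gap.  Cell `pub-ymgap` (HUMAN RULING D-0062), Track A node N06 [B9], seat
`pub-ymgap-dag-n06-i` (gen 13), 2026-08-27; a NEW file.
-/

noncomputable section

namespace Literature.MathematicalPhysics.QuantumFieldTheory.Balaban1983to89.B9Eq3132NuReadingR

open Node00
open B6KLevelCensusIndexV1 (KIdx)
open B9PinMembersKLevelV1 (MemberY geo9Y bg9Y)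
open B9BackgroundsKLevelV1R (RegFamY bg9YR regY335 regY336 siteKernelR)
open B9Eq3132CTInputs (CoerciveUnder DecayUnder)
open B9Eq3132ScalarIndex (geoComap InvNormalisedIdx stmt3132Printed_geo9Y_of_coercive_decay_idx)
open B9Eq3132RingInverseReading (normMatY)
open B9Eq3132NuReading (siteKernelOfOpNu nuY nuY_pos nuY_mul_lamInvY lamInvY lamInvY_pos invNormalisedIdx_nu_of_ringInverse opsYNuOfRecordV4E)
open scoped Matrix.Norms.L2Operator

variable {𝔸 : Type} [NormedRing 𝔸] [NormedAlgebra ℂ 𝔸] [CompleteSpace 𝔸]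
variable {d ℓ : ℕ} {hd : 1 ≤ d + 1} {hL : Odd (ℓ + 1) ∧ 1 < ℓ + 1} {b₀ b₁ : ℝ} {Mstar : ℕ}

/-! ## §1 ★ Row 26 for the `ν`-readings at the class-parametric carrier -/

section Row26

variable (G : Subgroup 𝔸ˣ) (R₁ R₂ : RegFamY d ℓ hd hL b₀ b₁ Mstar 𝔸) {Ff : Type} [Fintype Ff] [DecidableEq Ff] (b : Module.Basis Ff ℝ 𝔸)

omit [DecidableEq Ff] in
/-- the fibres of `Prod.fst` have `card Ff` elements. [folklore] -/
private theorem card_fiber_fst {X : Type} [Fintype X] [DecidableEq X] (y : X) :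
    (Finset.univ.filter fun a : X × Ff => a.1 = y).card = Fintype.card Ff := by
  rw [show (Finset.univ.filter fun a : X × Ff => a.1 = y) = ({y} : Finset X) ×ˢ (Finset.univ : Finset Ff) by
    ext ⟨a, f⟩
    simp [eq_comm]]
  simp

/-- ★ **ROW 26 (`B9.Stmt3132Printed`) FOR THE `ν`-READINGS OF TWO RING-INVERSE LETTERS AT THE CLASS-PARAMETRIC CARRIER `bg9YR 𝔸 G R₁ R₂`** from the four
Λ-normalised binders stated there — g7's `stmt3132Printed_nu_of_coercive_decay` with `bg9Y ↦ bg9YR 𝔸 G R₁ R₂` (the scalar-index Combes–Thomas pipeline is generic in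
the background family; no class axiom is consumed). [cite: Balaban1985BackgroundPropagators, (3.132) p.422, Thm 3.12 p.423 (prefix), (3.35)–(3.36) p.396; Balaban1984PropagatorsII, (2.81) p.237, Prop. 2.7 (2.149) p.249, Lemma 2.1 (2.60)–(2.61) p.234] -/
theorem stmt3132Printed_nu_of_coercive_decay_R (dd : ℕ) [∀ x : MemberY d ℓ hd hL b₀ b₁ Mstar, Fintype (geo9Y x).Site]
    [∀ x : MemberY d ℓ hd hL b₀ b₁ Mstar, DecidableEq (geo9Y x).Site] {c35 : ℝ}
    (T T₁ : ∀ x : MemberY d ℓ hd hL b₀ b₁ Mstar, CfgY 𝔸 x.toKIdx → Module.End ℂ ((geo9Y x).Site → 𝔸))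
    (hco : CoerciveUnder c35 (fun x => geoComap (geo9Y x) (Prod.fst : (geo9Y x).Site × Ff → (geo9Y x).Site)) (bg9YR 𝔸 G R₁ R₂)
      (fun x U => normMatY b (lamInvY x.toKIdx) (T x U)))
    (hdec : DecayUnder c35 (fun x => geoComap (geo9Y x) (Prod.fst : (geo9Y x).Site × Ff → (geo9Y x).Site)) (bg9YR 𝔸 G R₁ R₂)
      (fun x U => normMatY b (lamInvY x.toKIdx) (T x U)))
    (hco₁ : CoerciveUnder c35 (fun x => geoComap (geo9Y x) (Prod.fst : (geo9Y x).Site × Ff → (geo9Y x).Site)) (bg9YR 𝔸 G R₁ R₂)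
      (fun x U => normMatY b (lamInvY x.toKIdx) (T₁ x U)))
    (hdec₁ : DecayUnder c35 (fun x => geoComap (geo9Y x) (Prod.fst : (geo9Y x).Site × Ff → (geo9Y x).Site)) (bg9YR 𝔸 G R₁ R₂)
      (fun x U => normMatY b (lamInvY x.toKIdx) (T₁ x U))) :
    B9.Stmt3132Printed dd c35 (geo9Y (d := d) (ℓ := ℓ) (hd := hd) (hL := hL) (b₀ := b₀) (b₁ := b₁) (Mstar := Mstar)) (bg9YR 𝔸 G R₁ R₂)
      (fun x => siteKernelOfOpNu x.toKIdx (bg9YR 𝔸 G R₁ R₂ x) (fun U => U) (nuY dd x.toKIdx) (fun U => Ring.inverse (T x U)))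
      (fun x => siteKernelOfOpNu x.toKIdx (bg9YR 𝔸 G R₁ R₂ x) (fun U => U) (nuY dd x.toKIdx) (fun U => Ring.inverse (T₁ x U))) := by
  have hF : ∀ (x : MemberY d ℓ hd hL b₀ b₁ Mstar) (y : (geo9Y x).Site),
      (((Finset.univ.filter fun a : (geo9Y x).Site × Ff => a.1 = y).card : ℕ) : ℝ) ≤ (Fintype.card Ff : ℝ) :=
    fun x y => by rw [card_fiber_fst]
  have hνw : ∀ x : MemberY d ℓ hd hL b₀ b₁ Mstar,
      (fun y => nuY dd x.toKIdx y * lamInvY x.toKIdx y) = fun y => (geo9Y x).len y ^ (-(1 + (dd : ℝ) / 2)) :=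
    fun x => funext fun y => nuY_mul_lamInvY dd x.toKIdx y
  have hN : ∀ x : MemberY d ℓ hd hL b₀ b₁ Mstar,
      InvNormalisedIdx (g := geo9Y x)
        (siteKernelOfOpNu x.toKIdx (bg9YR 𝔸 G R₁ R₂ x) (fun U => U) (nuY dd x.toKIdx) (fun U => Ring.inverse (T x U)))
        (Prod.fst : (geo9Y x).Site × Ff → (geo9Y x).Site)
        (fun U => normMatY b (lamInvY x.toKIdx) (T x U)) (fun y => (geo9Y x).len y ^ (-(1 + (dd : ℝ) / 2))) := fun x => by
    rw [← hνw x]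
    exact invNormalisedIdx_nu_of_ringInverse b x.toKIdx (bg9YR 𝔸 G R₁ R₂ x) (fun U => U)
      (instF := (inferInstance : Fintype (geo9Y x).Site)) (instD := (inferInstance : DecidableEq (geo9Y x).Site)) (T x)
      (lamInvY_pos x.toKIdx) (fun y => (nuY_pos dd x.toKIdx y).le)
  have hN₁ : ∀ x : MemberY d ℓ hd hL b₀ b₁ Mstar,
      InvNormalisedIdx (g := geo9Y x)
        (siteKernelOfOpNu x.toKIdx (bg9YR 𝔸 G R₁ R₂ x) (fun U => U) (nuY dd x.toKIdx) (fun U => Ring.inverse (T₁ x U)))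
        (Prod.fst : (geo9Y x).Site × Ff → (geo9Y x).Site)
        (fun U => normMatY b (lamInvY x.toKIdx) (T₁ x U)) (fun y => (geo9Y x).len y ^ (-(1 + (dd : ℝ) / 2))) := fun x => by
    rw [← hνw x]
    exact invNormalisedIdx_nu_of_ringInverse b x.toKIdx (bg9YR 𝔸 G R₁ R₂ x) (fun U => U)
      (instF := (inferInstance : Fintype (geo9Y x).Site)) (instD := (inferInstance : DecidableEq (geo9Y x).Site)) (T₁ x)
      (lamInvY_pos x.toKIdx) (fun y => (nuY_pos dd x.toKIdx y).le)
  exact stmt3132Printed_geo9Y_of_coercive_decay_idx dd (fun x => (Prod.fst : (geo9Y x).Site × Ff → (geo9Y x).Site)) hF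
    hco hdec hco₁ hdec₁ hN hN₁

end Row26

/-! ## §2 ★★★ At def-Y's v4 instance of record `opsYNuOfRecordV4E`, kernels read through `siteKernelR R₁ R₂` -/

section RecordV4E

open B7Prop2SpecialUnitary (specialUnitaryUnits)
open B9Eq3132SectDLetters (QGQY QGQinvY)

variable {N : ℕ} (θ : Stage3Params) (Mstar : ℕ) (𝔯 : ResY N θ Mstar) (𝔢 : SectEY N θ Mstar) (𝔴 : RWEY N θ Mstar) (𝔈 : ExpsY N θ Mstar)
variable (R₁ R₂ : RegFamY θ.d₆ θ.ℓ₆ θ.hd' θ.hL' θ.b₀ θ.b₁ Mstar (Matrix (Fin N) (Fin N) ℂ))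

/-- the re-typed first row-26 kernel IS the `ν`-reading of the genuine `(QGQ*)⁻¹` at `bg9YR`. [cite: Balaban1985BackgroundPropagators, (3.132) p.422, bookkeeping] -/
theorem siteKernelR_opsYNuOfRecordV4E_QGQinv (x : MemberY θ.d₆ θ.ℓ₆ θ.hd' θ.hL' θ.b₀ θ.b₁ Mstar) :
    siteKernelR R₁ R₂ (opsYNuOfRecordV4E N θ Mstar 𝔯 𝔢 𝔴 𝔈 x).QGQinv =
      siteKernelOfOpNu x.toKIdx (bg9YR (Matrix (Fin N) (Fin N) ℂ) (specialUnitaryUnits (Fin N)) R₁ R₂ x) (fun U => U) (nuY (θ.d₆ + 1) x.toKIdx)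
        (QGQinvY x.toKIdx (parSymY x.toKIdx) (parBY x.toKIdx) (GpY x.toKIdx (parSymY x.toKIdx))) := rfl

/-- the re-typed second row-26 kernel IS the `ν`-reading of the genuine `(QG₁Q*)⁻¹` at `bg9YR`. [cite: Balaban1985BackgroundPropagators, (3.132) p.422, (3.129) p.421, bookkeeping] -/
theorem siteKernelR_opsYNuOfRecordV4E_QG1Qinv (x : MemberY θ.d₆ θ.ℓ₆ θ.hd' θ.hL' θ.b₀ θ.b₁ Mstar) :
    siteKernelR R₁ R₂ (opsYNuOfRecordV4E N θ Mstar 𝔯 𝔢 𝔴 𝔈 x).QG1Qinv =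
      siteKernelOfOpNu x.toKIdx (bg9YR (Matrix (Fin N) (Fin N) ℂ) (specialUnitaryUnits (Fin N)) R₁ R₂ x) (fun U => U) (nuY (θ.d₆ + 1) x.toKIdx)
        (QG1QinvY x.toKIdx (parSymY x.toKIdx) (parBY x.toKIdx) (GpY x.toKIdx (parSymY x.toKIdx)) (𝔯 x).Δ2) := rfl

/-- ★★★ **ROW 26 AT THE REPAIRED INSTANCE OF RECORD, RE-PRESSED AT THE CLASS-PARAMETRIC CARRIER** (CASCADE-R; the edition-8 face): from exactly the four
Λ-normalised estimate binders stated over `bg9YR M_N(ℂ) SU(N) R₁ R₂`, `B9.Stmt3132Printed (D) c35 geo9Y (bg9YR … R₁ R₂)` for the two row-26 kernels of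
`opsYNuOfRecordV4E` read through def-Y's `siteKernelR R₁ R₂`.  The same proof text as g7's `s3132Nu_opsYNuOfRecordV4E`; no class axiom consumed.
[cite: Balaban1985BackgroundPropagators, (3.132) p.422, Thm 3.12 p.423 (prefix), (3.35)–(3.36) p.396; Balaban1984PropagatorsII, (2.142) (2.147) p.248, Prop. 2.7 (2.149) p.249] -/
theorem s3132Nu_opsYNuOfRecordV4E_R [NeZero N] {c35 : ℝ}
    [∀ x : MemberY θ.d₆ θ.ℓ₆ θ.hd' θ.hL' θ.b₀ θ.b₁ Mstar, Fintype (geo9Y x).Site]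
    [∀ x : MemberY θ.d₆ θ.ℓ₆ θ.hd' θ.hL' θ.b₀ θ.b₁ Mstar, DecidableEq (geo9Y x).Site]
    {Ff : Type} [Fintype Ff] [DecidableEq Ff] (b : Module.Basis Ff ℝ (Matrix (Fin N) (Fin N) ℂ))
    (hco : CoerciveUnder c35
      (fun x : MemberY θ.d₆ θ.ℓ₆ θ.hd' θ.hL' θ.b₀ θ.b₁ Mstar => geoComap (geo9Y x) (Prod.fst : (geo9Y x).Site × Ff → (geo9Y x).Site))
      (bg9YR (Matrix (Fin N) (Fin N) ℂ) (specialUnitaryUnits (Fin N)) R₁ R₂)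
      (fun x U => normMatY b (lamInvY x.toKIdx) (QGQY x.toKIdx (parSymY x.toKIdx) (parBY x.toKIdx) (GpY x.toKIdx (parSymY x.toKIdx)) U)))
    (hdec : DecayUnder c35
      (fun x : MemberY θ.d₆ θ.ℓ₆ θ.hd' θ.hL' θ.b₀ θ.b₁ Mstar => geoComap (geo9Y x) (Prod.fst : (geo9Y x).Site × Ff → (geo9Y x).Site))
      (bg9YR (Matrix (Fin N) (Fin N) ℂ) (specialUnitaryUnits (Fin N)) R₁ R₂)
      (fun x U => normMatY b (lamInvY x.toKIdx) (QGQY x.toKIdx (parSymY x.toKIdx) (parBY x.toKIdx) (GpY x.toKIdx (parSymY x.toKIdx)) U)))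
    (hco₁ : CoerciveUnder c35
      (fun x : MemberY θ.d₆ θ.ℓ₆ θ.hd' θ.hL' θ.b₀ θ.b₁ Mstar => geoComap (geo9Y x) (Prod.fst : (geo9Y x).Site × Ff → (geo9Y x).Site))
      (bg9YR (Matrix (Fin N) (Fin N) ℂ) (specialUnitaryUnits (Fin N)) R₁ R₂)
      (fun x U => normMatY b (lamInvY x.toKIdx) (QGQOfY x.toKIdx (parBY x.toKIdx)
        (G1Y x.toKIdx (parSymY x.toKIdx) (parBY x.toKIdx) (GpY x.toKIdx (parSymY x.toKIdx)) (𝔯 x).Δ2) U)))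
    (hdec₁ : DecayUnder c35
      (fun x : MemberY θ.d₆ θ.ℓ₆ θ.hd' θ.hL' θ.b₀ θ.b₁ Mstar => geoComap (geo9Y x) (Prod.fst : (geo9Y x).Site × Ff → (geo9Y x).Site))
      (bg9YR (Matrix (Fin N) (Fin N) ℂ) (specialUnitaryUnits (Fin N)) R₁ R₂)
      (fun x U => normMatY b (lamInvY x.toKIdx) (QGQOfY x.toKIdx (parBY x.toKIdx)
        (G1Y x.toKIdx (parSymY x.toKIdx) (parBY x.toKIdx) (GpY x.toKIdx (parSymY x.toKIdx)) (𝔯 x).Δ2) U))) :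
    B9.Stmt3132Printed (θ.d₆ + 1) c35 (geo9Y (d := θ.d₆) (ℓ := θ.ℓ₆) (hd := θ.hd') (hL := θ.hL') (b₀ := θ.b₀) (b₁ := θ.b₁) (Mstar := Mstar))
      (bg9YR (Matrix (Fin N) (Fin N) ℂ) (specialUnitaryUnits (Fin N)) R₁ R₂)
      (fun x => siteKernelR R₁ R₂ (opsYNuOfRecordV4E N θ Mstar 𝔯 𝔢 𝔴 𝔈 x).QGQinv)
      (fun x => siteKernelR R₁ R₂ (opsYNuOfRecordV4E N θ Mstar 𝔯 𝔢 𝔴 𝔈 x).QG1Qinv) :=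
  stmt3132Printed_nu_of_coercive_decay_R (specialUnitaryUnits (Fin N)) R₁ R₂ b (θ.d₆ + 1)
    (fun x U => QGQY x.toKIdx (parSymY x.toKIdx) (parBY x.toKIdx) (GpY x.toKIdx (parSymY x.toKIdx)) U)
    (fun x U => QGQOfY x.toKIdx (parBY x.toKIdx) (G1Y x.toKIdx (parSymY x.toKIdx) (parBY x.toKIdx) (GpY x.toKIdx (parSymY x.toKIdx)) (𝔯 x).Δ2) U)
    hco hdec hco₁ hdec₁

/-- at MODULE 3's reading `(regY335, regY336)` the re-pressed face IS g7's landed `s3132Nu_opsYNuOfRecordV4E` (both carriers and both kernel families agree by `rfl`).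
[cite: Balaban1985BackgroundPropagators, (3.132) p.422, (3.35)–(3.36) p.396, bookkeeping] -/
theorem s3132Nu_opsYNuOfRecordV4E_R_regY [NeZero N] {c35 : ℝ}
    [∀ x : MemberY θ.d₆ θ.ℓ₆ θ.hd' θ.hL' θ.b₀ θ.b₁ Mstar, Fintype (geo9Y x).Site]
    [∀ x : MemberY θ.d₆ θ.ℓ₆ θ.hd' θ.hL' θ.b₀ θ.b₁ Mstar, DecidableEq (geo9Y x).Site] :
    B9.Stmt3132Printed (θ.d₆ + 1) c35 (geo9Y (d := θ.d₆) (ℓ := θ.ℓ₆) (hd := θ.hd') (hL := θ.hL') (b₀ := θ.b₀) (b₁ := θ.b₁) (Mstar := Mstar))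
        (bg9YR (Matrix (Fin N) (Fin N) ℂ) (specialUnitaryUnits (Fin N)) (regY335 (Matrix (Fin N) (Fin N) ℂ) (specialUnitaryUnits (Fin N)))
          (regY336 (Matrix (Fin N) (Fin N) ℂ) (specialUnitaryUnits (Fin N))))
        (fun x => siteKernelR (regY335 (Matrix (Fin N) (Fin N) ℂ) (specialUnitaryUnits (Fin N))) (regY336 (Matrix (Fin N) (Fin N) ℂ) (specialUnitaryUnits (Fin N)))
          (opsYNuOfRecordV4E N θ Mstar 𝔯 𝔢 𝔴 𝔈 x).QGQinv)
        (fun x => siteKernelR (regY335 (Matrix (Fin N) (Fin N) ℂ) (specialUnitaryUnits (Fin N))) (regY336 (Matrix (Fin N) (Fin N) ℂ) (specialUnitaryUnits (Fin N)))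
          (opsYNuOfRecordV4E N θ Mstar 𝔯 𝔢 𝔴 𝔈 x).QG1Qinv) ↔
      B9.Stmt3132Printed (θ.d₆ + 1) c35 (geo9Y (d := θ.d₆) (ℓ := θ.ℓ₆) (hd := θ.hd') (hL := θ.hL') (b₀ := θ.b₀) (b₁ := θ.b₁) (Mstar := Mstar))
        (bg9Y (Matrix (Fin N) (Fin N) ℂ) (specialUnitaryUnits (Fin N)))
        (fun x => (opsYNuOfRecordV4E N θ Mstar 𝔯 𝔢 𝔴 𝔈 x).QGQinv) (fun x => (opsYNuOfRecordV4E N θ Mstar 𝔯 𝔢 𝔴 𝔈 x).QG1Qinv) :=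
  Iff.rfl

end RecordV4E

end Literature.MathematicalPhysics.QuantumFieldTheory.Balaban1983to89.B9Eq3132NuReadingR

end
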